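import Mathlib
import Literature.AlgebraicGeometry.Resolution.CompleteFiniteness

/-!
# `MuOrdinaryFamilyRT` — the commutative algebra of crux idea `eg-coverage-nakayama`

Support lemmas (sorry-free) for crux `stmt-Langlands-13757`
(`Summit.Langlands.Langlands.Theses.PicardMuOrdinary.MuOrdinaryFamilyRT`), idea
`Cruxes/MuOrdinaryFamilyRT/Ideas/eg-coverage-nakayama.md` (strategist s2, 2026-08-17): the step
"`Λ`-adic finiteness from finitely many fixed weights".  Abstractly: `R → A` a local homomorphism of
local rings (`R` = the weight algebra `Λ`, complete; `A` = the `Λ`-ordinary global deformation ring,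
Noetherian local with the same residue field), and finitely many surjections
`gⱼ : A ⧸ 𝔪_R A ↠ Bⱼ` onto ARTINIAN rings (`Bⱼ` = the fixed-weight-`λ(kⱼ)` global deformation ring
modulo `ϖ`, Artinian by fixed-weight `R = T` finiteness) whose kernels have NIL intersection (the
Emerton–Gee coverage statement, base-changed to the global ring).  Then `𝔪_A` is nilpotent modulo
`𝔪_R A`, and complete Nakayama (Matsumura Thm. 8.4, as assembled in
`Literature.AlgebraicGeometry.Resolution.module_finite_of_isAdicComplete_of_residue_surjective`)
makes `A` a finite `R`-module.

* `pow_maximalIdeal_le_of_nilKernels` — the nilpotence of `𝔪_A` modulo `J` from the finitely many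
  nil-kernel surjections onto Artinian rings;
* `moduleFinite_of_nilKernels` — the finiteness conclusion (several weights);
* `moduleFinite_of_nilKernel` — the one-weight special case.
-/


namespace Summit.Langlands.Langlands.Cruxes.MuOrdinaryFamilyRT.EGCoverageNakayama

open IsLocalRing

universe u v w

/-- If `g : A ⧸ J ↠ B` is a surjection onto an Artinian ring and `x ∈ 𝔪_A`, then the image of `x`
in `B` is nilpotent: it lies in the Jacobson radical of `B` (every `1 + x·a` is a unit of the local
ring `A`), which is nilpotent. -/
theorem isNilpotent_map_mk_of_mem_maximalIdeal {A : Type u} {B : Type v} [CommRing A] [CommRing B]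
    [IsLocalRing A] [IsArtinianRing B] (J : Ideal A) (g : A ⧸ J →+* B)
    (hg : Function.Surjective g) {x : A} (hx : x ∈ maximalIdeal A) :
    IsNilpotent (g (Ideal.Quotient.mk J x)) := by
  have hjac : g (Ideal.Quotient.mk J x) ∈ Ideal.jacobson (⊥ : Ideal B) := by
    rw [Ideal.mem_jacobson_bot]
    intro y
    obtain ⟨a', rfl⟩ := hg y
    obtain ⟨a, rfl⟩ := Ideal.Quotient.mk_surjective a'
    have hu : IsUnit (x * a + 1) := by
      -- `x * a ∈ 𝔪_A`, so `1 + x * a` is a unit of the local ring `A`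
      have hmem : x * a ∈ maximalIdeal A := Ideal.mul_mem_right a _ hx
      by_contra hnu
      have : x * a + 1 ∈ maximalIdeal A := (mem_maximalIdeal _).mpr hnu
      have h1 : (1 : A) ∈ maximalIdeal A := by
        simpa using (Ideal.sub_mem _ this hmem)
      exact (maximalIdeal.isMaximal A).ne_top (Ideal.eq_top_of_isUnit_mem _ h1 isUnit_one)
    simpa using (hu.map (Ideal.Quotient.mk J)).map g
  obtain ⟨n, hn⟩ := IsArtinianRing.isNilpotent_jacobson_bot (R := B)
  refine ⟨n, ?_⟩
  have : g (Ideal.Quotient.mk J x) ^ n ∈ Ideal.jacobson (⊥ : Ideal B) ^ n :=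
    Ideal.pow_mem_pow hjac n
  rw [hn] at this
  simpa using this

/-- **Nilpotence of `𝔪_A` modulo `J` from finitely many nil-kernel surjections onto Artinian rings.**
`A` Noetherian local, `J` an ideal, `gⱼ : A ⧸ J ↠ Bⱼ` (`j ∈ ι`, finite) surjections onto Artinian
rings with `⋂ⱼ ker gⱼ ⊆ nil(A ⧸ J)`.  Then `𝔪_A ^ N ⊆ J` for some `N`. -/
theorem pow_maximalIdeal_le_of_nilKernels {A : Type u} [CommRing A] [IsLocalRing A]
    [IsNoetherianRing A] (J : Ideal A) {ι : Type w} [Finite ι] (B : ι → Type v)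
    [∀ j, CommRing (B j)] [∀ j, IsArtinianRing (B j)] (g : ∀ j, A ⧸ J →+* B j)
    (hg : ∀ j, Function.Surjective (g j))
    (hker : ⨅ j, RingHom.ker (g j) ≤ nilradical (A ⧸ J)) :
    ∃ N, maximalIdeal A ^ N ≤ J := by
  classical
  -- every element of `𝔪_A` becomes nilpotent in `A ⧸ J`
  have hnil : (maximalIdeal A).map (Ideal.Quotient.mk J) ≤ nilradical (A ⧸ J) := by
    rw [Ideal.map_le_iff_le_comap]
    intro x hx
    rw [Ideal.mem_comap]
    -- a common exponent killing all the images `g j (mk x)`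
    have hex : ∀ j, ∃ n : ℕ, (g j) (Ideal.Quotient.mk J x) ^ n = 0 := fun j =>
      isNilpotent_map_mk_of_mem_maximalIdeal J (g j) (hg j) hx
    choose n hn using hex
    haveI := Fintype.ofFinite ι
    set N : ℕ := ∑ j, n j with hN
    have hpow : (Ideal.Quotient.mk J x) ^ N ∈ ⨅ j, RingHom.ker (g j) := by
      rw [Ideal.mem_iInf]
      intro j
      rw [RingHom.mem_ker, map_pow]
      have hle : n j ≤ N := by
        rw [hN]
        exact Finset.single_le_sum (fun i _ => Nat.zero_le (n i)) (Finset.mem_univ j)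
      obtain ⟨m, hm⟩ := Nat.exists_eq_add_of_le hle
      rw [hm, pow_add, hn j, zero_mul]
    have hxN : IsNilpotent ((Ideal.Quotient.mk J x) ^ N) := by
      simpa [mem_nilradical] using hker hpow
    obtain ⟨m, hm⟩ := hxN
    rw [mem_nilradical]
    exact ⟨N * m, by rw [pow_mul]; exact hm⟩
  -- the nilradical of the Noetherian ring `A ⧸ J` is nilpotent
  obtain ⟨L, hL⟩ := IsNoetherianRing.isNilpotent_nilradical (A ⧸ J)
  refine ⟨L, ?_⟩
  have h1 : ((maximalIdeal A).map (Ideal.Quotient.mk J)) ^ L = ⊥ := by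
    refine le_bot_iff.mp ?_
    calc ((maximalIdeal A).map (Ideal.Quotient.mk J)) ^ L ≤ (nilradical (A ⧸ J)) ^ L :=
          Ideal.pow_right_mono hnil L
      _ = ⊥ := hL
  rw [← Ideal.map_pow, Ideal.map_eq_bot_iff_le_ker, Ideal.mk_ker] at h1
  exact h1

/-- **`Λ`-adic finiteness from finitely many fixed weights (abstract form).**  `R → A` a local
homomorphism of local rings, `R` `𝔪_R`-adically complete, `A` Noetherian, `R → A ⧸ 𝔪_A` onto; if there
are finitely many surjections `gⱼ : A ⧸ 𝔪_R A ↠ Bⱼ` onto Artinian rings whose kernels have nil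
intersection, then `A` is a finite `R`-module. -/
theorem moduleFinite_of_nilKernels {R : Type u} {A : Type v} [CommRing R] [CommRing A]
    [Algebra R A] [IsLocalRing R] [IsLocalRing A] [IsNoetherianRing A]
    [IsAdicComplete (maximalIdeal R) R]
    (hloc : (maximalIdeal R).map (algebraMap R A) ≤ maximalIdeal A)
    (hres : Function.Surjective ((residue A).comp (algebraMap R A)))
    {ι : Type w} [Finite ι] (B : ι → Type v) [∀ j, CommRing (B j)] [∀ j, IsArtinianRing (B j)]
    (g : ∀ j, A ⧸ (maximalIdeal R).map (algebraMap R A) →+* B j)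
    (hg : ∀ j, Function.Surjective (g j))
    (hker : ⨅ j, RingHom.ker (g j) ≤ nilradical (A ⧸ (maximalIdeal R).map (algebraMap R A))) :
    Module.Finite R A :=
  Literature.AlgebraicGeometry.Resolution.module_finite_of_isAdicComplete_of_residue_surjective
    hloc hres (pow_maximalIdeal_le_of_nilKernels _ B g hg hker)

/-- The one-weight special case: a single nil-kernel surjection `A ⧸ 𝔪_R A ↠ B` onto an Artinian
ring suffices. -/
theorem moduleFinite_of_nilKernel {R : Type u} {A : Type v} [CommRing R] [CommRing A]
    [Algebra R A] [IsLocalRing R] [IsLocalRing A] [IsNoetherianRing A]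
    [IsAdicComplete (maximalIdeal R) R]
    (hloc : (maximalIdeal R).map (algebraMap R A) ≤ maximalIdeal A)
    (hres : Function.Surjective ((residue A).comp (algebraMap R A)))
    {B : Type v} [CommRing B] [IsArtinianRing B]
    (g : A ⧸ (maximalIdeal R).map (algebraMap R A) →+* B) (hg : Function.Surjective g)
    (hker : RingHom.ker g ≤ nilradical (A ⧸ (maximalIdeal R).map (algebraMap R A))) :
    Module.Finite R A :=
  moduleFinite_of_nilKernels hloc hres (ι := Unit) (fun _ => B) (fun _ => g) (fun _ => hg)
    ((iInf_le (fun _ : Unit => RingHom.ker g) ()).trans hker)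

end Summit.Langlands.Langlands.Cruxes.MuOrdinaryFamilyRT.EGCoverageNakayama
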